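import Mathlib.MeasureTheory.Measure.OpenPos
import Mathlib.MeasureTheory.Integral.Bochner.Basic
import Mathlib.MeasureTheory.Constructions.BorelSpace.Basic
import Literature.Analysis.FluidPDE.StretchedLayerSliceCalculus
import HarnessLib

/-!
# The energy class of the stretched layer system: tails hypothesis and real-variable tools

Analysis/FluidPDE file (one definition, one hypothesis structure, everything else proved). The
**energy-class tails**
`StretchedLayer.HasLayerEnergyTails u v` of a velocity field of the stretched two-dimensional
Navier–Stokes layer system (`StretchedLayerNS`): for every `T > 0`, (i) on `(0, T] × ℝ²` the
velocity and its `y`-slice derivatives are bounded and the `x`-slice derivatives decay like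
`C e^{−k|y|}` across the layer; (ii) on `[δ, T] × ℝ²`, `δ > 0`, the time derivatives and the pure
second slice derivatives are bounded. This is the side condition under which the `L²` energy
method on the period strip (Majda–Bertozzi 2002, §3.1.1 Prop. 3.1 / Cor. 3.1 and the Remark
after Prop. 3.4) proves period rigidity / uniqueness (`StretchedLayerEnergyRigidity`); it is
invariant under `x`-translation (`HasLayerEnergyTails.translate`), constrains one solution only,
and asks decay of `∂ₓ(u, v)` alone (so that shift differences `∫ₓ^{x+ℓ} ∂ₓ(u,v)` are square
integrable on the strip without naming a background profile).

`StripEnergyHypotheses L γ ν U V u v a b p a' b'` bundles, at a fixed time, the hypotheses of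
the basic energy inequality on the period strip for the linearised/difference form of the system
(consumed by `StretchedLayerStripEnergy`, produced from a solution and its translate by
`StretchedLayerShiftSystem`).

The rest of the file is the real-variable toolkit of the rigidity proof: continuity of slices
and of the time-derivative slice of a jointly `C²` field, vanishing of a nonnegative continuous
function with zero strip integral, extension of vanishing from `(0, L)` to `ℝ` by periodicity,
and the Grönwall step "`e' ≤ Ke`, `e ≥ 0`, `e(0) = 0` ⇒ `e ≡ 0`" in differential form
(`antitoneOn_of_deriv_nonpos` applied to `e^{−Kt}e(t)`, as in `EnergyUniqueness`). All of it is
folklore.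
-/

noncomputable section

open Set Function Filter
open _root_.MeasureTheory
open scoped Topology

namespace Literature.Analysis.FluidPDE

namespace StretchedLayer

/-! ### The energy-class tails -/

/-- **Energy-class tails** of a velocity field `(u, v)` of the stretched layer system (a side
condition, not implied by `IsStretchedLayerNSSolutionOn`): for every `T > 0`,
(i) on `(0, T] × ℝ²` the velocity and its `y`-slice derivatives are bounded and the `x`-slice
derivatives decay like `C e^{-k|y|}` across the layer (so the shift difference
`(u,v)(x+ℓ) − (u,v)(x) = ∫ₓ^{x+ℓ} ∂ₓ(u,v)` is square integrable on the period strip, uniformly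
down to `t = 0⁺`); (ii) on `[δ, T] × ℝ²`, `δ > 0`, the time derivatives and the pure second slice
derivatives are bounded (so the strip energy is `C¹`, the pressure gradient — read off the
momentum equations — grows at most linearly in `y`, and all integrations by parts are
legitimate). Invariant under `x`-translation; satisfied by Gaussian-tailed solutions; no clause
on the pressure. This is the finite-energy-perturbation class of Majda–Bertozzi 2002, §3.1.3,
Remark after Prop. 3.4, for the strained shear layer. [folklore] -/
def HasLayerEnergyTails (u v : ℝ → ℝ → ℝ → ℝ) : Prop :=
  ∀ T : ℝ, 0 < T →
    (∃ C k : ℝ, 0 < k ∧ ∀ t ∈ Set.Ioc 0 T, ∀ x y : ℝ,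
      |u t x y| + |v t x y| + |dY (u t) x y| + |dY (v t) x y| ≤ C ∧
      |dX (u t) x y| + |dX (v t) x y| ≤ C * Real.exp (-k * |y|)) ∧
    (∀ δ : ℝ, 0 < δ → ∃ C' : ℝ, ∀ t ∈ Set.Icc δ T, ∀ x y : ℝ,
      |deriv (fun s => u s x y) t| + |deriv (fun s => v s x y) t| +
        |dX (dX (u t)) x y| + |dY (dY (u t)) x y| + |dX (dX (v t)) x y| + |dY (dY (v t)) x y| ≤ C')

/-- `HasLayerEnergyTails` is invariant under `x`-translation (all its bounds are uniform in `x`;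
slice derivatives of translates are translates of slice derivatives). [folklore] -/
theorem HasLayerEnergyTails.translate {u v : ℝ → ℝ → ℝ → ℝ} (h : HasLayerEnergyTails u v)
    (ℓ : ℝ) : HasLayerEnergyTails (fun t x y => u t (x + ℓ) y) (fun t x y => v t (x + ℓ) y) := by
  intro T hT
  obtain ⟨⟨C, k, hk, h1⟩, h2⟩ := h T hT
  have eXX : ∀ (f : ℝ → ℝ → ℝ) (x y : ℝ),
      dX (dX (fun a b => f (a + ℓ) b)) x y = dX (dX f) (x + ℓ) y := fun f x y => by
    rw [dX_translate_fun]; exact dX_translate (dX f) ℓ x y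
  refine ⟨⟨C, k, hk, fun t ht x y => ?_⟩, fun δ hδ => ?_⟩
  · have key := h1 t ht (x + ℓ) y
    rw [dX_translate (u t), dX_translate (v t), dY_translate (u t), dY_translate (v t)]
    exact key
  · obtain ⟨C', h3⟩ := h2 δ hδ
    refine ⟨C', fun t ht x y => ?_⟩
    have key := h3 t ht (x + ℓ) y
    rw [eXX (u t), eXX (v t), dY_translate_fun (u t), dY_translate_fun (v t), dY_translate,
      dY_translate]
    exact key

/-! ### Hypotheses of the basic energy inequality on the period strip -/

/-- **Hypotheses of the basic energy inequality on the period strip** (fixed time) for the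
linearised/difference form of the stretched layer system: a divergence-free `C²` perturbation
`(a, b)` with pressure `p` and time-derivative fields `a', b'`, transported by the divergence-free
`C¹` field `(U, V)` with strain drift `−γy∂_y` and strained by `∇(u, v)`:
`a' + U∂ₓa + (V − γy)∂_ya + a∂ₓu + b∂_yu = −∂ₓp + νΔa`,
`b' + U∂ₓb + (V − γy)∂_yb + a∂ₓv + b∂_yv − γb = −∂_yp + νΔb`, `∂ₓa + ∂_yb = 0`; `a, b, p, U`
`L`-periodic in `x`; `a, b, ∂ₓa, ∂ₓb` decaying like `e^{−k|y|}` across the layer; `∂_y(a,b)`,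
the pure second slice derivatives of `(a, b)` and `U, V, ∂ₓU, ∂_yV` bounded; `|p| ≲ (1 + |y|)²`,
`|∇p| ≲ 1 + |y|` (Majda–Bertozzi 2002, §3.1.1 and Remark after Prop. 3.4: the finite-energy
perturbation class in which the basic energy estimate runs). [folklore] -/
structure StripEnergyHypotheses (L γ ν : ℝ) (U V u v a b p a' b' : ℝ → ℝ → ℝ) : Prop where
  /-- `a ∈ C²(ℝ²)`. -/
  contDiff_a : ContDiff ℝ 2 (fun q : ℝ × ℝ => a q.1 q.2)
  /-- `b ∈ C²(ℝ²)`. -/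
  contDiff_b : ContDiff ℝ 2 (fun q : ℝ × ℝ => b q.1 q.2)
  /-- `p ∈ C¹(ℝ²)`. -/
  contDiff_p : ContDiff ℝ 1 (fun q : ℝ × ℝ => p q.1 q.2)
  /-- `U ∈ C¹(ℝ²)`. -/
  contDiff_U : ContDiff ℝ 1 (fun q : ℝ × ℝ => U q.1 q.2)
  /-- `V ∈ C¹(ℝ²)`. -/
  contDiff_V : ContDiff ℝ 1 (fun q : ℝ × ℝ => V q.1 q.2)
  /-- `u ∈ C¹(ℝ²)`. -/
  contDiff_u : ContDiff ℝ 1 (fun q : ℝ × ℝ => u q.1 q.2)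
  /-- `v ∈ C¹(ℝ²)`. -/
  contDiff_v : ContDiff ℝ 1 (fun q : ℝ × ℝ => v q.1 q.2)
  /-- The linearised `x`-momentum equation. -/
  eq_a : ∀ x y, a' x y + U x y * dX a x y + (V x y - γ * y) * dY a x y + a x y * dX u x y +
    b x y * dY u x y = -dX p x y + ν * lap a x y
  /-- The linearised `y`-momentum equation (with the stretching term `−γb`). -/
  eq_b : ∀ x y, b' x y + U x y * dX b x y + (V x y - γ * y) * dY b x y + a x y * dX v x y +
    b x y * dY v x y - γ * b x y = -dY p x y + ν * lap b x y
  /-- `∂ₓa + ∂_yb = 0`. -/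
  divFree : ∀ x y, dX a x y + dY b x y = 0
  /-- `∂ₓU + ∂_yV = 0`. -/
  divFree_UV : ∀ x y, dX U x y + dY V x y = 0
  /-- `a` is `L`-periodic in `x`. -/
  periodic_a : ∀ x y, a (x + L) y = a x y
  /-- `b` is `L`-periodic in `x`. -/
  periodic_b : ∀ x y, b (x + L) y = b x y
  /-- `p` is `L`-periodic in `x`. -/
  periodic_p : ∀ x y, p (x + L) y = p x y
  /-- `U` is `L`-periodic in `x`. -/
  periodic_U : ∀ x y, U (x + L) y = U x y
  /-- `a, b, ∂ₓa, ∂ₓb` decay across the layer like `A e^{−k|y|}`. -/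
  decay : ∃ k A : ℝ, 0 < k ∧ 0 ≤ A ∧ ∀ x y,
    |a x y| ≤ A * Real.exp (-k * |y|) ∧ |b x y| ≤ A * Real.exp (-k * |y|) ∧
    |dX a x y| ≤ A * Real.exp (-k * |y|) ∧ |dX b x y| ≤ A * Real.exp (-k * |y|)
  /-- `∂_ya, ∂_yb` are bounded. -/
  bounded_dY : ∃ B : ℝ, ∀ x y, |dY a x y| ≤ B ∧ |dY b x y| ≤ B
  /-- The pure second slice derivatives of `a, b` are bounded. -/
  bounded_dd : ∃ B : ℝ, ∀ x y, |dX (dX a) x y| ≤ B ∧ |dY (dY a) x y| ≤ B ∧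
    |dX (dX b) x y| ≤ B ∧ |dY (dY b) x y| ≤ B
  /-- `U, V, ∂ₓU, ∂_yV` are bounded. -/
  bounded_UV : ∃ B : ℝ, ∀ x y, |U x y| ≤ B ∧ |V x y| ≤ B ∧ |dX U x y| ≤ B ∧ |dY V x y| ≤ B
  /-- `|p| ≤ Q(1 + |y|)²`, `|∂ₓp|, |∂_yp| ≤ Q(1 + |y|)`. -/
  pressure : ∃ Q : ℝ, ∀ x y, |p x y| ≤ Q * (1 + |y|) ^ 2 ∧ |dX p x y| ≤ Q * (1 + |y|) ∧
    |dY p x y| ≤ Q * (1 + |y|)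

/-! ### Continuity of slices of space–time fields -/

/-- Space slices `q ↦ u s q.1 q.2`, `s ≥ 0`, of a field continuous on `[0, ∞) × ℝ²` are
continuous. [folklore] -/
theorem continuous_slice_of_continuousOn_Ici {u : ℝ → ℝ → ℝ → ℝ}
    (hu : ContinuousOn (fun q : ℝ × ℝ × ℝ => u q.1 q.2.1 q.2.2) (Ici 0 ×ˢ univ)) {s : ℝ}
    (hs : 0 ≤ s) : Continuous (fun q : ℝ × ℝ => u s q.1 q.2) :=
  hu.comp_continuous (continuous_const.prodMk continuous_id) fun q => ⟨hs, mem_univ q⟩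

/-- Time lines `s ↦ u s x y` of a field continuous on `[0, ∞) × ℝ²` are continuous on `[0, ∞)`.
[folklore] -/
theorem continuousOn_time_of_continuousOn_Ici {u : ℝ → ℝ → ℝ → ℝ}
    (hu : ContinuousOn (fun q : ℝ × ℝ × ℝ => u q.1 q.2.1 q.2.2) (Ici 0 ×ˢ univ)) (x y : ℝ) :
    ContinuousOn (fun s => u s x y) (Ici 0) :=
  hu.comp (f := fun s : ℝ => ((s, x, y) : ℝ × ℝ × ℝ))
    (continuous_id.prodMk continuous_const).continuousOn fun _ hs => ⟨hs, mem_univ _⟩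

/-- **The time-derivative slice is continuous in space**: for a field jointly `C²` on `S × ℝ²`,
`S` open, `t ∈ S`, the plane field `(x, y) ↦ ∂ₜu(t, x, y)` is continuous (it is the joint Fréchet
derivative applied to `(1, 0, 0)`). [folklore] -/
theorem continuous_deriv_time {S : Set ℝ} (hS : IsOpen S) {u : ℝ → ℝ → ℝ → ℝ}
    (hu : ContDiffOn ℝ 2 (fun q : ℝ × ℝ × ℝ => u q.1 q.2.1 q.2.2) (S ×ˢ univ)) {t : ℝ}
    (ht : t ∈ S) : Continuous (fun q : ℝ × ℝ => deriv (fun s => u s q.1 q.2) t) := by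
  have hO : IsOpen (S ×ˢ (univ : Set (ℝ × ℝ))) := hS.prod isOpen_univ
  have hcont : ContinuousOn (fun r => fderiv ℝ (fun q : ℝ × ℝ × ℝ => u q.1 q.2.1 q.2.2) r)
      (S ×ˢ univ) := hu.continuousOn_fderiv_of_isOpen hO (by norm_num)
  have hderiv : ∀ q : ℝ × ℝ, deriv (fun s => u s q.1 q.2) t =
      fderiv ℝ (fun q : ℝ × ℝ × ℝ => u q.1 q.2.1 q.2.2) (t, q) (1, 0) := by
    intro q
    have hmem : (t, q) ∈ S ×ˢ (univ : Set (ℝ × ℝ)) := ⟨ht, mem_univ _⟩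
    have hd : DifferentiableAt ℝ (fun q : ℝ × ℝ × ℝ => u q.1 q.2.1 q.2.2) (t, q) :=
      (hu.differentiableOn two_ne_zero _ hmem).differentiableAt (hO.mem_nhds hmem)
    have h1 : HasDerivAt (fun s : ℝ => (s, q)) (1, 0) t :=
      (hasDerivAt_id t).prodMk (hasDerivAt_const t q)
    exact (hd.hasFDerivAt.comp_hasDerivAt t h1).deriv
  have e : (fun q : ℝ × ℝ => deriv (fun s => u s q.1 q.2) t) =
      fun q => fderiv ℝ (fun q : ℝ × ℝ × ℝ => u q.1 q.2.1 q.2.2) (t, q) (1, 0) := funext hderiv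
  rw [e]
  exact (hcont.comp_continuous (continuous_const.prodMk continuous_id)
    fun q => ⟨ht, mem_univ q⟩).clm_apply continuous_const

/-- Time lines of a field jointly `C²` on `(0, ∞) × ℝ²` are differentiable at every `t > 0`, with
derivative `deriv`. [folklore] -/
theorem hasDerivAt_time_of_contDiffOn_Ioi {u : ℝ → ℝ → ℝ → ℝ}
    (hu : ContDiffOn ℝ 2 (fun q : ℝ × ℝ × ℝ => u q.1 q.2.1 q.2.2) (Ioi 0 ×ˢ univ)) {t : ℝ}
    (ht : 0 < t) (x y : ℝ) : HasDerivAt (fun s => u s x y) (deriv (fun s => u s x y) t) t :=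
  ((differentiableWithinAt_time hu two_ne_zero ht x y).differentiableAt
    (Ioi_mem_nhds ht)).hasDerivAt

/-! ### Vanishing from a zero strip integral, and extension by periodicity -/

/-- A nonnegative continuous function on the plane with zero integral over the strip
`(0, L] × ℝ` vanishes on the open strip `(0, L) × ℝ` (open sets of positive measure). [folklore] -/
theorem eq_zero_of_setIntegral_strip_eq_zero {L : ℝ} {F : ℝ × ℝ → ℝ} (hF : Continuous F)
    (h0 : ∀ q, 0 ≤ F q) (hI : IntegrableOn F (Ioc 0 L ×ˢ univ))
    (hint : ∫ q in Ioc 0 L ×ˢ univ, F q = 0) {x : ℝ} (hx : x ∈ Ioo 0 L) (y : ℝ) :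
    F (x, y) = 0 := by
  have hae : F =ᵐ[volume.restrict (Ioc 0 L ×ˢ univ)] 0 :=
    (integral_eq_zero_iff_of_nonneg (fun q => h0 q) hI).1 hint
  rw [Filter.EventuallyEq, ae_restrict_iff' (measurableSet_Ioc.prod MeasurableSet.univ)] at hae
  by_contra hne
  set U : Set (ℝ × ℝ) := {q | F q ≠ 0} ∩ Ioo 0 L ×ˢ univ with hU_def
  have hUo : IsOpen U := (isOpen_ne_fun hF continuous_const).inter (isOpen_Ioo.prod isOpen_univ)
  have hUne : U.Nonempty := ⟨(x, y), hne, hx, mem_univ _⟩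
  have hpos : 0 < volume U := hUo.measure_pos volume hUne
  have hnull : volume U = 0 := by
    refine measure_mono_null (fun q hq => ?_) (ae_iff.1 hae)
    simp only [mem_setOf_eq, Classical.not_imp]
    exact ⟨⟨Ioo_subset_Ioc_self hq.2.1, mem_univ _⟩, hq.1⟩
  exact hpos.ne' hnull

/-- A continuous `L`-periodic function (`L > 0`) vanishing on `(0, L)` vanishes identically
(closure, then periodicity). [folklore] -/
theorem eq_zero_of_eq_zero_on_Ioo_of_periodic {g : ℝ → ℝ} {L : ℝ} (hL : 0 < L)
    (hg : Continuous g) (hper : ∀ x, g (x + L) = g x) (h0 : ∀ x ∈ Ioo 0 L, g x = 0) (x : ℝ) :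
    g x = 0 := by
  have hIcc : ∀ x ∈ Icc 0 L, g x = 0 := by
    have hcl : closure (Ioo 0 L) ⊆ {x | g x = 0} :=
      (isClosed_eq hg continuous_const).closure_subset_iff.2 h0
    rw [closure_Ioo hL.ne] at hcl
    exact hcl
  have h1 := abs_le_of_periodic hL hper (fun x hx => (abs_eq_zero.2 (hIcc x hx)).le) x
  exact abs_eq_zero.1 (le_antisymm h1 (abs_nonneg _))

/-! ### Grönwall to zero -/

/-- **Grönwall, differential form, zero data**: if `e` is continuous on `[0, T]`, nonnegative,
`e(0) = 0`, and at every `s ∈ (0, T)` it has a derivative `φ ≤ K e(s)`, then `e ≡ 0` on `[0, T]`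
(`t ↦ e^{−Kt} e(t)` is nonincreasing; Majda–Bertozzi 2002, Lemma 3.1 / proof of Cor. 3.1).
[folklore] -/
theorem eq_zero_of_hasDerivAt_le_mul {e : ℝ → ℝ} {T K : ℝ} (hcont : ContinuousOn e (Icc 0 T))
    (hderiv : ∀ s ∈ Ioo 0 T, ∃ φ, HasDerivAt e φ s ∧ φ ≤ K * e s)
    (hnonneg : ∀ s ∈ Icc 0 T, 0 ≤ e s) (he0 : e 0 = 0) {t : ℝ} (ht : t ∈ Icc 0 T) : e t = 0 := by
  have hT : 0 ≤ T := ht.1.trans ht.2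
  choose! φ hφ using hderiv
  set g : ℝ → ℝ := fun s => Real.exp (-K * s) * e s with hg_def
  have hgd : ∀ s ∈ Ioo 0 T, HasDerivAt g
      (Real.exp (-K * s) * (-K * 1) * e s + Real.exp (-K * s) * φ s) s :=
    fun s hs => (((hasDerivAt_id s).const_mul (-K)).exp).mul (hφ s hs).1
  have hanti : AntitoneOn g (Icc 0 T) := by
    refine antitoneOn_of_deriv_nonpos (convex_Icc 0 T) ?_ ?_ ?_
    · exact ((Real.continuous_exp.comp (continuous_const.mul continuous_id)).continuousOn).mul
        hcont
    · rw [interior_Icc]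
      exact fun s hs => (hgd s hs).differentiableAt.differentiableWithinAt
    · rw [interior_Icc]
      intro s hs
      rw [(hgd s hs).deriv]
      have h3 := (hφ s hs).2
      have hexp : 0 < Real.exp (-K * s) := Real.exp_pos _
      nlinarith [mul_le_mul_of_nonneg_left h3 hexp.le]
  have h0T : (0 : ℝ) ∈ Icc 0 T := ⟨le_rfl, hT⟩
  have hgt : g t ≤ g 0 := hanti h0T ht ht.1
  have hg0 : g 0 = 0 := by simp [hg_def, he0]
  have hexp : 0 < Real.exp (-K * t) := Real.exp_pos _
  have hle : Real.exp (-K * t) * e t ≤ Real.exp (-K * t) * 0 := by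
    rw [mul_zero]; exact hgt.trans_eq hg0
  exact le_antisymm (le_of_mul_le_mul_left hle hexp) (hnonneg t ht)

end StretchedLayer

end Literature.Analysis.FluidPDE
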